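import Mathlib
import Literature.Analysis.SpecialFunctions.BesselHeatKernel
import HarnessLib

/-!
# The radial heat kernels of real index: Gaussian concentration away from the diagonal

For `ν ≥ 0`, `x > 0` and the kernels `q^{(ν)}_τ(x,z) = τ⁻¹ e^{-(x²+z²)/2τ} I_ν(xz/τ)` of `BesselHeatKernel.lean`
(measure `z dz` on `(0,∞)`), the Gaussian majorant `I_ν(w) ≤ (w/2)^ν e^w/Γ(ν+1)` gives:
* `besselHeatKernel_mul_rpow_le_far` — off the diagonal (`|z - x| ≥ δ`, `τ ≤ 1`):
  `q^{(ν)}_τ(x,z) z^p ≤ C(x,ν) τ^{-(1+ν)} e^{-δ²/(4τ)} z^{ν+p} e^{-z²/8}`;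
* `tendsto_setIntegral_besselHeatKernel_far` — CONCENTRATION: `∫_{z>0, |z-x| ≥ δ} q^{(ν)}_τ(x,z) z^p dz → 0` as `τ → 0⁺`
  (`δ > 0`, `p ≥ 0`; exponential beats polynomial), and its weight-`z` form;
* `integrableOn_besselHeatKernel_mul_rpow` (& corollaries) — `z ↦ q^{(ν)}_τ(x,z) z^p` is integrable on `(0,∞)`.
Companion file `BesselHeatKernelApproxIdentity.lean` adds the mass limit and the approximate-identity property
[RevuzYor1999, Ch. XI §1].

## References
* D. Revuz, M. Yor, *Continuous Martingales and Brownian Motion*, 3rd ed. (1999), Ch. XI §1. [RevuzYor1999]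
* NIST DLMF §10.25. [DLMF]
-/

noncomputable section

open Filter Topology Real MeasureTheory Set
open scoped Nat BigOperators

namespace Literature.Analysis.SpecialFunctions

/-! ## Continuity and measurability -/

/-- `I_ν` is continuous (`ν ≥ 0`). [cite: DLMF, 10.25.2] -/
theorem continuous_besselIR {ν : ℝ} (hν : 0 ≤ ν) : Continuous (besselIR ν) := by
  unfold besselIR
  exact ((Real.continuous_rpow_const hν).comp (continuous_id.div_const 2)).mul
    ((continuous_besselP hν).comp (by fun_prop))

/-- `z ↦ q^{(ν)}_τ(x,z)` is continuous. [cite: RevuzYor1999, Ch. XI §1] -/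
theorem continuous_besselHeatKernel_right {ν : ℝ} (hν : 0 ≤ ν) (τ x : ℝ) :
    Continuous fun z => besselHeatKernel ν τ x z := by
  unfold besselHeatKernel
  exact (continuous_const.mul (by fun_prop)).mul ((continuous_besselIR hν).comp (by fun_prop))

/-! ## The Gaussian majorant away from the diagonal -/

section Majorant

variable {ν x : ℝ}

/-- Recentring a Gaussian: `e^{-(x-z)²/4} ≤ e^{x²/4} e^{-z²/8}`. [folklore] -/
private theorem exp_recentre (x z : ℝ) : Real.exp (-(x - z) ^ 2 / 4) ≤ Real.exp (x ^ 2 / 4) * Real.exp (-(z ^ 2) / 8) := by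
  rw [← Real.exp_add]
  refine Real.exp_le_exp.2 ?_
  nlinarith [sq_nonneg (z - 2 * x), sq_nonneg (x - z)]

/-- **Off-diagonal majorant**: for `0 < τ ≤ 1`, `z > 0`, `|z - x| ≥ δ`,
`q^{(ν)}_τ(x,z) z^p ≤ [(x/2)^ν e^{x²/4}/Γ(ν+1)] · τ^{-(1+ν)} e^{-δ²/(4τ)} · z^{ν+p} e^{-z²/8}`. [cite: RevuzYor1999, Ch. XI §1] -/
theorem besselHeatKernel_mul_rpow_le_far (hν : 0 ≤ ν) (hx : 0 < x) {δ τ z p : ℝ} (hτ : 0 < τ) (hτ1 : τ ≤ 1)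
    (hz : 0 < z) (hfar : δ ≤ |z - x|) (hδ : 0 < δ) :
    besselHeatKernel ν τ x z * z ^ p ≤
      ((x / 2) ^ ν * Real.exp (x ^ 2 / 4) / Real.Gamma (ν + 1)) *
        (τ ^ (-(1 + ν)) * Real.exp (-(δ ^ 2) / (4 * τ))) * (z ^ (ν + p) * Real.exp (-(z ^ 2) / 8)) := by
  have hG : 0 < Real.Gamma (ν + 1) := Real.Gamma_pos_of_pos (by linarith)
  have hK := besselHeatKernel_le hν hτ hx.le hz.le
  -- split the rpow and the Gaussian
  have h1 : (x * z / (2 * τ)) ^ ν = (x / 2) ^ ν * z ^ ν * τ ^ (-ν) := by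
    rw [show x * z / (2 * τ) = (x / 2) * z * τ⁻¹ by field_simp, Real.mul_rpow (by positivity) (by positivity),
      Real.mul_rpow (by positivity) hz.le, Real.rpow_neg hτ.le, Real.inv_rpow hτ.le]
  have h2 : Real.exp (-(x - z) ^ 2 / (2 * τ)) ≤ Real.exp (-(δ ^ 2) / (4 * τ)) * Real.exp (-(x - z) ^ 2 / 4) := by
    rw [← Real.exp_add]
    refine Real.exp_le_exp.2 ?_
    have hsq : δ ^ 2 ≤ (x - z) ^ 2 := by
      rw [← sq_abs (x - z), abs_sub_comm]
      exact pow_le_pow_left₀ hδ.le hfar 2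
    have hA : (x - z) ^ 2 / (4 * τ) ≥ δ ^ 2 / (4 * τ) := by
      apply div_le_div_of_nonneg_right hsq; positivity
    have hB : (x - z) ^ 2 / (4 * τ) ≥ (x - z) ^ 2 / 4 := by
      rw [ge_iff_le, div_le_div_iff₀ (by norm_num) (by positivity)]
      nlinarith [sq_nonneg (x - z)]
    have : -(x - z) ^ 2 / (2 * τ) = -((x - z) ^ 2 / (4 * τ)) - (x - z) ^ 2 / (4 * τ) := by field_simp; ring
    rw [this]
    have : -(δ ^ 2) / (4 * τ) + -(x - z) ^ 2 / 4 = -(δ ^ 2 / (4 * τ)) - (x - z) ^ 2 / 4 := by ring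
    rw [this]
    linarith
  have h3 := exp_recentre x z
  have h4 : τ⁻¹ * τ ^ (-ν) = τ ^ (-(1 + ν)) := by
    rw [neg_add, Real.rpow_add hτ, Real.rpow_neg_one]
  calc besselHeatKernel ν τ x z * z ^ p
      ≤ τ⁻¹ * (x * z / (2 * τ)) ^ ν * Real.exp (-(x - z) ^ 2 / (2 * τ)) / Real.Gamma (ν + 1) * z ^ p :=
        mul_le_mul_of_nonneg_right hK (Real.rpow_nonneg hz.le p)
    _ = (x / 2) ^ ν / Real.Gamma (ν + 1) * (τ⁻¹ * τ ^ (-ν)) * (z ^ ν * z ^ p) * Real.exp (-(x - z) ^ 2 / (2 * τ)) := by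
        rw [h1]; ring
    _ ≤ (x / 2) ^ ν / Real.Gamma (ν + 1) * (τ⁻¹ * τ ^ (-ν)) * (z ^ ν * z ^ p) *
          (Real.exp (-(δ ^ 2) / (4 * τ)) * (Real.exp (x ^ 2 / 4) * Real.exp (-(z ^ 2) / 8))) := by
        refine mul_le_mul_of_nonneg_left (h2.trans (mul_le_mul_of_nonneg_left h3 (Real.exp_nonneg _))) ?_
        positivity
    _ = _ := by rw [h4, ← Real.rpow_add hz]; ring

/-- The polynomially weighted Gaussian `z^q e^{-z²/8}` is integrable on `(0,∞)` (`q ≥ 0`). [folklore] -/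
private theorem integrableOn_rpow_mul_exp_eighth {q : ℝ} (hq : 0 ≤ q) :
    IntegrableOn (fun z : ℝ => z ^ q * Real.exp (-(z ^ 2) / 8)) (Ioi 0) := by
  have h := integrableOn_rpow_mul_exp_neg_mul_sq (b := 1 / 8) (by norm_num) (s := q) (by linarith)
  refine h.congr_fun (fun z _ => ?_) measurableSet_Ioi
  show z ^ q * Real.exp (-(1 / 8) * z ^ 2) = z ^ q * Real.exp (-(z ^ 2) / 8)
  rw [show -(1 / 8 : ℝ) * z ^ 2 = -(z ^ 2) / 8 by ring]

/-- The off-diagonal constant tends to zero: `τ^{-(1+ν)} e^{-δ²/(4τ)} → 0` as `τ → 0⁺`. [folklore] -/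
private theorem tendsto_rpow_neg_mul_exp_neg_div (ν : ℝ) {δ : ℝ} (hδ : 0 < δ) :
    Tendsto (fun τ : ℝ => τ ^ (-(1 + ν)) * Real.exp (-(δ ^ 2) / (4 * τ))) (𝓝[>] 0) (𝓝 0) := by
  have h := (tendsto_rpow_mul_exp_neg_mul_atTop_nhds_zero (1 + ν) (δ ^ 2 / 4) (by positivity)).comp
    tendsto_inv_nhdsGT_zero
  refine h.congr' ?_
  filter_upwards [self_mem_nhdsWithin] with τ hτ
  have hτ' : (0 : ℝ) < τ := hτ
  simp only [Function.comp]
  rw [Real.inv_rpow hτ'.le, ← Real.rpow_neg hτ'.le]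
  congr 1; congr 1
  field_simp

/-- **Concentration**: for `δ > 0`, `p ≥ 0`, `∫_{z > 0, |z - x| ≥ δ} q^{(ν)}_τ(x,z) z^p dz → 0` as `τ → 0⁺`.
[cite: RevuzYor1999, Ch. XI §1] -/
theorem tendsto_setIntegral_besselHeatKernel_far (hν : 0 ≤ ν) (hx : 0 < x) {δ : ℝ} (hδ : 0 < δ) {p : ℝ} (hp : 0 ≤ p) :
    Tendsto (fun τ : ℝ => ∫ z in {z : ℝ | 0 < z ∧ δ ≤ |z - x|}, besselHeatKernel ν τ x z * z ^ p)
      (𝓝[>] 0) (𝓝 0) := by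
  set S : Set ℝ := {z : ℝ | 0 < z ∧ δ ≤ |z - x|} with hS
  have hSm : MeasurableSet S :=
    (measurableSet_lt measurable_const measurable_id).inter
      (measurableSet_le measurable_const ((measurable_id.sub measurable_const).abs))
  have hSsub : S ⊆ Ioi 0 := fun z hz => hz.1
  set C : ℝ := (x / 2) ^ ν * Real.exp (x ^ 2 / 4) / Real.Gamma (ν + 1) with hC
  set W : ℝ := ∫ z in Ioi (0 : ℝ), z ^ (ν + p) * Real.exp (-(z ^ 2) / 8) with hW
  have hWint := integrableOn_rpow_mul_exp_eighth (q := ν + p) (by positivity)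
  -- squeeze between `0` and `C · c(τ) · W`
  have hupper : Tendsto (fun τ : ℝ => C * (τ ^ (-(1 + ν)) * Real.exp (-(δ ^ 2) / (4 * τ))) * W) (𝓝[>] 0) (𝓝 0) := by
    have := ((tendsto_rpow_neg_mul_exp_neg_div ν hδ).const_mul C).mul_const W
    simpa using this
  refine tendsto_of_tendsto_of_tendsto_of_le_of_le' tendsto_const_nhds hupper ?_ ?_
  · filter_upwards [self_mem_nhdsWithin] with τ hτ
    refine setIntegral_nonneg hSm fun z hz => ?_
    exact mul_nonneg (besselHeatKernel_pos hν hτ hx hz.1).le (Real.rpow_nonneg hz.1.le p)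
  · have h1 : Ioo (0 : ℝ) 1 ∈ 𝓝[>] (0 : ℝ) := Ioo_mem_nhdsGT one_pos
    filter_upwards [h1] with τ hτ
    have hτ0 : 0 < τ := hτ.1
    have hbound : ∀ z ∈ S, besselHeatKernel ν τ x z * z ^ p ≤
        C * (τ ^ (-(1 + ν)) * Real.exp (-(δ ^ 2) / (4 * τ))) * (z ^ (ν + p) * Real.exp (-(z ^ 2) / 8)) :=
      fun z hz => besselHeatKernel_mul_rpow_le_far hν hx hτ.1 hτ.2.le hz.1 hz.2 hδ
    have hcont : ContinuousOn (fun z => besselHeatKernel ν τ x z * z ^ p) S :=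
      ((continuous_besselHeatKernel_right hν τ x).continuousOn.mul
        ((Real.continuous_rpow_const hp).continuousOn))
    have hdom : IntegrableOn (fun z => C * (τ ^ (-(1 + ν)) * Real.exp (-(δ ^ 2) / (4 * τ))) *
        (z ^ (ν + p) * Real.exp (-(z ^ 2) / 8))) S := (hWint.mono_set hSsub).const_mul _
    have hint : IntegrableOn (fun z => besselHeatKernel ν τ x z * z ^ p) S := by
      refine Integrable.mono' hdom (hcont.aestronglyMeasurable hSm) ?_
      refine ae_restrict_of_forall_mem hSm fun z hz => ?_
      rw [Real.norm_eq_abs, abs_of_nonneg (mul_nonneg (besselHeatKernel_pos hν hτ.1 hx hz.1).le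
        (Real.rpow_nonneg hz.1.le p))]
      exact hbound z hz
    calc ∫ z in S, besselHeatKernel ν τ x z * z ^ p
        ≤ ∫ z in S, C * (τ ^ (-(1 + ν)) * Real.exp (-(δ ^ 2) / (4 * τ))) * (z ^ (ν + p) * Real.exp (-(z ^ 2) / 8)) :=
          setIntegral_mono_on hint hdom hSm hbound
      _ = C * (τ ^ (-(1 + ν)) * Real.exp (-(δ ^ 2) / (4 * τ))) *
            ∫ z in S, z ^ (ν + p) * Real.exp (-(z ^ 2) / 8) := integral_const_mul _ _
      _ ≤ C * (τ ^ (-(1 + ν)) * Real.exp (-(δ ^ 2) / (4 * τ))) * W := by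
          refine mul_le_mul_of_nonneg_left ?_ ?_
          · exact setIntegral_mono_set hWint
              (ae_restrict_of_forall_mem measurableSet_Ioi fun z (hz : 0 < z) =>
                mul_nonneg (Real.rpow_nonneg hz.le _) (Real.exp_nonneg _))
              (ae_of_all _ hSsub)
          · have : 0 < Real.Gamma (ν + 1) := Real.Gamma_pos_of_pos (by linarith)
            positivity

end Majorant

/-! ## Integrability on `(0,∞)` -/

section Integrable

variable {ν x : ℝ}

/-- `z ↦ q^{(ν)}_τ(x,z) z^p` is integrable on `(0,∞)` (`ν, p ≥ 0`, `τ, x > 0`): Gaussian majorant. [cite: RevuzYor1999, Ch. XI §1] -/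
theorem integrableOn_besselHeatKernel_mul_rpow (hν : 0 ≤ ν) (hx : 0 < x) {τ : ℝ} (hτ : 0 < τ) {p : ℝ} (hp : 0 ≤ p) :
    IntegrableOn (fun z => besselHeatKernel ν τ x z * z ^ p) (Ioi 0) := by
  have hG : 0 < Real.Gamma (ν + 1) := Real.Gamma_pos_of_pos (by linarith)
  -- majorant `C z^{ν+p} e^{-z²/(4τ)}`
  set C : ℝ := τ⁻¹ * ((x / 2) ^ ν * τ ^ (-ν)) * Real.exp (x ^ 2 / (2 * τ)) / Real.Gamma (ν + 1) with hC
  have hdom : IntegrableOn (fun z : ℝ => C * (z ^ (ν + p) * Real.exp (-(1 / (4 * τ)) * z ^ 2))) (Ioi 0) :=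
    (integrableOn_rpow_mul_exp_neg_mul_sq (b := 1 / (4 * τ)) (by positivity) (s := ν + p) (by linarith)).const_mul C
  refine Integrable.mono' hdom ?_ ?_
  · exact ((continuous_besselHeatKernel_right hν τ x).mul (Real.continuous_rpow_const hp)).aestronglyMeasurable
  · refine ae_restrict_of_forall_mem measurableSet_Ioi fun z hz => ?_
    have hz' : (0 : ℝ) < z := hz
    rw [Real.norm_eq_abs, abs_of_nonneg (mul_nonneg (besselHeatKernel_pos hν hτ hx hz').le (Real.rpow_nonneg hz'.le p))]
    have hK := besselHeatKernel_le hν hτ hx.le hz'.le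
    have h1 : (x * z / (2 * τ)) ^ ν = (x / 2) ^ ν * z ^ ν * τ ^ (-ν) := by
      rw [show x * z / (2 * τ) = (x / 2) * z * τ⁻¹ by field_simp, Real.mul_rpow (by positivity) (by positivity),
        Real.mul_rpow (by positivity) hz'.le, Real.rpow_neg hτ.le, Real.inv_rpow hτ.le]
    have h2 : Real.exp (-(x - z) ^ 2 / (2 * τ)) ≤ Real.exp (x ^ 2 / (2 * τ)) * Real.exp (-(1 / (4 * τ)) * z ^ 2) := by
      rw [← Real.exp_add]
      refine Real.exp_le_exp.2 ?_
      have e1 : -(x - z) ^ 2 / (2 * τ) = (-2 * (x - z) ^ 2) / (4 * τ) := by field_simp; ring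
      have e2 : x ^ 2 / (2 * τ) + -(1 / (4 * τ)) * z ^ 2 = (2 * x ^ 2 - z ^ 2) / (4 * τ) := by field_simp; ring
      rw [e1, e2]
      exact div_le_div_of_nonneg_right (by nlinarith [sq_nonneg (2 * x - z)]) (by positivity)
    calc besselHeatKernel ν τ x z * z ^ p
        ≤ τ⁻¹ * (x * z / (2 * τ)) ^ ν * Real.exp (-(x - z) ^ 2 / (2 * τ)) / Real.Gamma (ν + 1) * z ^ p :=
          mul_le_mul_of_nonneg_right hK (Real.rpow_nonneg hz'.le p)
      _ = τ⁻¹ * ((x / 2) ^ ν * τ ^ (-ν)) / Real.Gamma (ν + 1) * (z ^ ν * z ^ p) * Real.exp (-(x - z) ^ 2 / (2 * τ)) := by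
          rw [h1]; ring
      _ ≤ τ⁻¹ * ((x / 2) ^ ν * τ ^ (-ν)) / Real.Gamma (ν + 1) * (z ^ ν * z ^ p) *
            (Real.exp (x ^ 2 / (2 * τ)) * Real.exp (-(1 / (4 * τ)) * z ^ 2)) :=
          mul_le_mul_of_nonneg_left h2 (by positivity)
      _ = C * (z ^ (ν + p) * Real.exp (-(1 / (4 * τ)) * z ^ 2)) := by
          rw [hC, ← Real.rpow_add hz']; ring

/-- Integrability of `z ↦ q^{(ν)}_τ(x,z) z` on `(0,∞)`. [cite: RevuzYor1999, Ch. XI §1] -/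
theorem integrableOn_besselHeatKernel_mul (hν : 0 ≤ ν) (hx : 0 < x) {τ : ℝ} (hτ : 0 < τ) :
    IntegrableOn (fun z => besselHeatKernel ν τ x z * z) (Ioi 0) := by
  refine (integrableOn_besselHeatKernel_mul_rpow hν hx hτ zero_le_one).congr_fun (fun z _ => ?_) measurableSet_Ioi
  simp only [Real.rpow_one]

/-- Integrability of `z ↦ q^{(ν)}_τ(x,z) z^ν z` on `(0,∞)`. [cite: RevuzYor1999, Ch. XI §1] -/
theorem integrableOn_besselHeatKernel_mul_rpow_mul (hν : 0 ≤ ν) (hx : 0 < x) {τ : ℝ} (hτ : 0 < τ) :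
    IntegrableOn (fun z => besselHeatKernel ν τ x z * z ^ ν * z) (Ioi 0) := by
  refine (integrableOn_besselHeatKernel_mul_rpow hν hx hτ (p := ν + 1) (by linarith)).congr_fun
    (fun z hz => ?_) measurableSet_Ioi
  have hz' : (0 : ℝ) < z := hz
  simp only [Real.rpow_add_one hz'.ne', mul_assoc]

/-- The far integrals in the two weights used below tend to zero. [cite: RevuzYor1999, Ch. XI §1] -/
theorem tendsto_setIntegral_besselHeatKernel_far_one (hν : 0 ≤ ν) (hx : 0 < x) {δ : ℝ} (hδ : 0 < δ) :
    Tendsto (fun τ : ℝ => ∫ z in {z : ℝ | 0 < z ∧ δ ≤ |z - x|}, besselHeatKernel ν τ x z * z) (𝓝[>] 0) (𝓝 0) := by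
  refine (tendsto_setIntegral_besselHeatKernel_far hν hx hδ zero_le_one).congr' ?_
  filter_upwards [self_mem_nhdsWithin] with τ _
  refine setIntegral_congr_fun ((measurableSet_lt measurable_const measurable_id).inter
      (measurableSet_le measurable_const ((measurable_id.sub measurable_const).abs))) fun z _ => ?_
  simp only [Real.rpow_one]

end Integrable

end Literature.Analysis.SpecialFunctions

end
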